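/-
Origin: expansion seat `planner-pub-hodgecm-toy2-g5-0`, handover #10 2026-08-18T09:20:20Z (`HOME/pub-hodgecm-toy2-g5/lean/Toy2g5/ToyPadH0FundDescent.lean`, md5 06a27572, 122 lines);
landed by the gen-7 packager in gate run 27 as `HodgeCM/Model/Toy/ToyPadH0FundDescent.lean` (import ^import Toy2g5\.PadH0FundDescent\b→import HodgeCM.Model.PadH0FundDescent ×1; import ^import Toy2g5\.ToyPadH0Fund\b→import HodgeCM.Model.Toy.ToyPadH0Fund ×1; stripped 3 #print/#check/#eval lines).
-/
/-
Copyright: pub-hodgecm formalisation cell (harness21, 2026). New file (not vendored).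
Origin: HOME/pub-hodgecm-toy2-g5/lean/Toy2g5/ToyPadH0FundDescent.lean — session planner-pub-hodgecm-toy2-g5-0 (unit pub-hodgecm-toy2-g5,
CONSISTENCY seat 2, part (6a)(ii), generation 5).  WIP module `Toy2g5.ToyPadH0FundDescent`; intended final place
`HodgeCM/Model/Toy/ToyPadH0FundDescent.lean` (module `HodgeCM.Model.Toy.ToyPadH0FundDescent`).  TWO imports to rewrite on landing:
`Toy2g5.ToyPadH0Fund` ↦ `HodgeCM.Model.Toy.ToyPadH0Fund`, `Toy2g5.PadH0FundDescent` ↦ `HodgeCM.Model.PadH0FundDescent`.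
-/
import Summits.HodgeConjecture.HodgeCM.Model.Toy.ToyPadH0Fund
import Summits.HodgeConjecture.HodgeCM.Model.PadH0FundDescent
import Summits.HodgeConjecture.HodgeCM.Model.Toy.ToyUnitH0

/-!
# F7d `Fact_gysinDescent` (M41), F7d-B and `Fact_unitH0` are independent: the model `toyModel♭⁰`

Continuation of `HodgeCM.Model.Toy.ToyPadH0Fund` (`h0PadModel = toyModel.padH0 toyModel.padDatumH0`), using
`HodgeCM.Model.PadH0FundDescent`.  Truth table (each row a theorem below or in the files cited):

| statement                                                      | `toyModel` | `h0PadModel` |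
|----------------------------------------------------------------|:----------:|:------------:|
| `FundContext` (M1–M28, N1–N4, F4, F5, dimProd, W_RK4, PohlmannSpan, Qw8MilnePos) | true | true |
| F7 `Fact_gysin` (all traces vanish in both: vacuous)           | true       | true         |
| **F7d = M41 `Fact_gysinDescent`**                              | true       | **false**    |
| **F7d-B `Fact_gysinDescentB`**                                 | true       | **false**    |
| **`Fact_unitH0`**                                              | true       | **false**    |

Headlines: `HodgeCM.Toy.fact_gysinDescent_independent`, `fact_gysinDescentB_independent`, `fact_unitH0_independent` — each of
F7d, F7d-B, `Fact_unitH0` is independent of `FundContext ∧ Fact_gysin` (both truth values realised).  In particular the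
trace-injectivity input of the kernel derivation `gysinDescent_of_gysin : Fact_gysin → Fact_trTopCM → Fact_gysinDescent` is
load-bearing.  FACTS §1c P5 row F7d (M41): 'none filed' → `fact_gysinDescent_independent`.  Nothing is cited.
-/

noncomputable section

namespace HodgeCM.Toy

open Literature.AlgebraicGeometry.Motives (CMType HodgeStructure)
open Universe GysinWitness

/-- Every CM product of the exterior model carries a nonzero rational top class: `H^{2 dim A′} = ⋀^{rk L} L` is a line. -/
theorem exists_top_ne_zero (F : CMField) {m : ℕ} (Θ' : Fin (m + 1) → CMType F) :
    ∃ ω : toyModel.Coh (toyModel.cmProd F Θ') (2 * toyModel.dim (toyModel.cmProd F Θ')), ω ≠ 0 := by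
  have hr : Module.finrank ℚ (toyModel.Coh (toyModel.cmProd F Θ') (2 * toyModel.dim (toyModel.cmProd F Θ'))) = 1 := by
    change Module.finrank ℚ ↥(⋀[ℚ]^(2 * TM.dim (TM.cmProd F Θ')) (TM.cmProd F Θ').L) = 1
    rw [exteriorPower.finrank_eq, two_mul_dim_eq_card, card_Idx, Nat.choose_self]
  haveI := Module.nontrivial_of_finrank_eq_succ hr
  exact exists_ne 0

/-- Hence some block `Y′` carries a nonzero rational top class (one factor on each side). -/
theorem toyModel_exists_blockTop_ne_zero :
    ∃ (F : CMField) (n m : ℕ) (Ξ : Fin (n + 1 + (m + 1)) → CMType F)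
      (ω : toyModel.Coh (toyModel.cmProd F (blkB Ξ)) (2 * toyModel.dim (toyModel.cmProd F (blkB Ξ)))), ω ≠ 0 := by
  obtain ⟨F, -, -, f, -, -⟩ := faceHypothesesInhabited
  let Ξ : Fin (0 + 1 + (0 + 1)) → CMType F := fun _ => f.Φ
  obtain ⟨ω, hω⟩ := exists_top_ne_zero F (blkB Ξ)
  exact ⟨F, 0, 0, Ξ, ω, hω⟩

/-- (Ported verbatim from the HodgeCMPerL package; no docstring in the source.) -/
theorem toyModel_fact_gysin : toyModel.Fact_gysin := fact_gysin exteriorHodgeData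

/-- F7 holds in `toyModel♭⁰` (vacuously, all traces of the exterior model vanish). -/
theorem h0PadModel_fact_gysin : h0PadModel.Fact_gysin := PadH0Fund.fact_gysin_of_tr_eq_zero fun X k => tr_eq X k

/-- **F7d = M41 fails in `toyModel♭⁰`.** -/
theorem not_h0PadModel_fact_gysinDescent : ¬ h0PadModel.Fact_gysinDescent :=
  PadH0Fund.not_fact_gysinDescent toyModel_modelAxioms toyModel_fact_dimProd (cmProdH0Nontrivial exteriorHodgeData)
    toyModel_exists_blockTop_ne_zero

/-- **F7d-B fails in `toyModel♭⁰`.** -/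
theorem not_h0PadModel_fact_gysinDescentB : ¬ h0PadModel.Fact_gysinDescentB :=
  PadH0Fund.not_fact_gysinDescentB toyModel_modelAxioms toyModel_fact_dimProd (cmProdH0Nontrivial exteriorHodgeData)
    toyModel_exists_blockTop_ne_zero

/-- **`Fact_unitH0` fails in `toyModel♭⁰`.** -/
theorem not_h0PadModel_fact_unitH0 : ¬ h0PadModel.Fact_unitH0 :=
  PadH0Fund.not_fact_unitH0 (cmProdH0Nontrivial exteriorHodgeData)

/-- (Ported verbatim from the HodgeCMPerL package; no docstring in the source.) -/
theorem h0PadModel_descentProfile :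
    FundContext h0PadModel ∧ h0PadModel.Fact_gysin ∧ ¬ h0PadModel.Fact_gysinDescent ∧ ¬ h0PadModel.Fact_gysinDescentB ∧
      ¬ h0PadModel.Fact_unitH0 ∧ ¬ h0PadModel.Fact_fundClass ∧ ¬ h0PadModel.Qw8MilneZero ∧ ¬ h0PadModel.HC_CM :=
  ⟨h0PadModel_fundContext, h0PadModel_fact_gysin, not_h0PadModel_fact_gysinDescent, not_h0PadModel_fact_gysinDescentB,
    not_h0PadModel_fact_unitH0, not_h0PadModel_fact_fundClass, not_h0PadModel_qw8MilneZero, not_h0PadModel_hc_cm⟩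

/-- (Ported verbatim from the HodgeCMPerL package; no docstring in the source.) -/
theorem toyModel_descentProfile :
    FundContext toyModel ∧ toyModel.Fact_gysin ∧ toyModel.Fact_gysinDescent ∧ toyModel.Fact_gysinDescentB ∧
      toyModel.Fact_unitH0 ∧ toyModel.Fact_fundClass ∧ toyModel.Qw8MilneZero ∧ toyModel.HC_CM :=
  ⟨toyModel_fundContext, toyModel_fact_gysin, toyModel_fact_gysinDescent, toyModel_fact_gysinDescentB, toyModel_fact_unitH0,
    toyModel_fact_fundClass, toyModel_qw8MilneZero, toyModel_hc_cm⟩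

/-- **F7d = M41 `Fact_gysinDescent` is INDEPENDENT of `ModelAxioms ∧ N1–N4 ∧ F4 ∧ F5 ∧ F7 ∧ Fact_dimProd ∧ W_RK4 ∧ PohlmannSpan ∧
Qw8MilnePos`** (`toyModel`: true; `toyModel♭⁰`: false). -/
theorem fact_gysinDescent_independent :
    (∃ U : Universe, FundContext U ∧ U.Fact_gysin ∧ U.Fact_gysinDescent) ∧
      (∃ U : Universe, FundContext U ∧ U.Fact_gysin ∧ ¬ U.Fact_gysinDescent) :=
  ⟨⟨toyModel, toyModel_fundContext, toyModel_fact_gysin, toyModel_fact_gysinDescent⟩,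
    ⟨h0PadModel, h0PadModel_fundContext, h0PadModel_fact_gysin, not_h0PadModel_fact_gysinDescent⟩⟩

/-- **F7d-B `Fact_gysinDescentB` is INDEPENDENT of the same list.** -/
theorem fact_gysinDescentB_independent :
    (∃ U : Universe, FundContext U ∧ U.Fact_gysin ∧ U.Fact_gysinDescentB) ∧
      (∃ U : Universe, FundContext U ∧ U.Fact_gysin ∧ ¬ U.Fact_gysinDescentB) :=
  ⟨⟨toyModel, toyModel_fundContext, toyModel_fact_gysin, toyModel_fact_gysinDescentB⟩,
    ⟨h0PadModel, h0PadModel_fundContext, h0PadModel_fact_gysin, not_h0PadModel_fact_gysinDescentB⟩⟩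

/-- **`Fact_unitH0` is INDEPENDENT of the same list.** -/
theorem fact_unitH0_independent :
    (∃ U : Universe, FundContext U ∧ U.Fact_gysin ∧ U.Fact_unitH0) ∧
      (∃ U : Universe, FundContext U ∧ U.Fact_gysin ∧ ¬ U.Fact_unitH0) :=
  ⟨⟨toyModel, toyModel_fundContext, toyModel_fact_gysin, toyModel_fact_unitH0⟩,
    ⟨h0PadModel, h0PadModel_fundContext, h0PadModel_fact_gysin, not_h0PadModel_fact_unitH0⟩⟩

/-- F7d does not follow from F7 and the rest of the list (the trace-injectivity input of `gysinDescent_of_gysin` is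
load-bearing). -/
theorem not_fact_gysinDescent_of_fundContext_gysin :
    ¬ ∀ U : Universe, FundContext U → U.Fact_gysin → U.Fact_gysinDescent :=
  fun h => not_h0PadModel_fact_gysinDescent (h h0PadModel h0PadModel_fundContext h0PadModel_fact_gysin)


end HodgeCM.Toy

end
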